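import Literature.Computability.QuantumComplexity.HadamardGadgetDescBricks
import Literature.Computability.Complexity.IterateFPPoly
import HarnessLib

/-!
# The Hadamard gadget, VIII: the slot step of the description printer

Topic `Literature/Computability/QuantumComplexity`; sequel of `HadamardGadgetDescBricks.lean`
(Bremner–Jozsa–Shepherd 2011, proof of Thm. 1; uniformity half). The closed-form op codes of the
padded gadget circuit (`HGadget.gadgetCodes`) are printed by a left fold over the gate codes of
`F.circ n` with accumulator `⟨bin k, emitted⟩` (`Brick.foldFn`, `ListFoldBricks.lean`); this file
builds **the step of that fold**, `HGadget.slotStep`, and proves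

* `slotStep_apply`: on `⟨w, ⟨code g, ⟨bin k, em⟩⟩⟩` with `w = ⟨⟨y₂, ⟨1^N, ⟨⟨bin n, bin T⟩, bin N⟩⟩⟩, L⟩`
  it returns `⟨bin (k + extra g + 2N), em ++ encList (codes of slotOps N k g, relabelled by ρ)⟩`
  — the gate's own operations by a branch on the symbol, the two Hadamard layers by `layerF`;
* `slotStep ∈ FP` and a *polynomial* growth bound `|slotStep v| ≤ |acc| + G(|w|)` on every input
  (`length_slotStep_le`; every numeral read from the code or the accumulator is clipped to
  `|w| + 1` symbols, an identity on genuine runs), whence the fold is in `FP` by a polynomial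
  variant `foldFn_mem_FP_of_poly` of the fold brick (through `iterate_mem_FP_of_growth_poly`).

## References

* S. Arora, B. Barak, *Computational Complexity: A Modern Approach*, CUP 2009, §1.3, §1.4.1,
  §6.2, Remark 6.7.
* M. J. Bremner, R. Jozsa, D. J. Shepherd, Proc. R. Soc. A 467 (2011), Thm. 1 (proof), p. 7.
-/

noncomputable section

namespace Literature.Computability.QuantumComplexity

open _root_.Computability Complexity Cryptography Brick Polynomial

namespace HGadget

/-! ### A fold brick with polynomially growing rounds -/

/-- **Growth of one round of the list fold, polynomial form**: if
`|step ⟨u, ⟨a, acc⟩⟩| ≤ |acc| + G(|u|)` on every input then `|foldRound step z| ≤ |z| + G(|fstF z|) + 4`.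
[folklore] -/
theorem length_foldRound_le_poly {step : List Bool → List Bool} {G : Polynomial ℕ}
    (hstep : ∀ v, (step v).length ≤ (sndF (sndF v)).length + G.eval (fstF v).length) (z : List Bool) :
    (foldRound step z).length ≤ z.length + (G.eval (fstF z).length + 4) := by
  have h0 := length_fstF_sndF_le z
  have h1 := length_fstF_sndF_le (sndF z)
  have h2 := length_fstF_sndF_le (fstF (sndF z))
  rw [foldRound, iteFn_of_oneBit (oneBit_isNilFn.comp _)]
  split_ifs
  · rw [length_fanoutFn, length_fanoutFn]
    simp only [nthF, sndPow, Function.comp_apply]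
    omega
  · rw [length_fanoutFn, length_fanoutFn]
    simp only [nthF, Function.comp_apply]
    have hs := hstep (stepArg z)
    have harg : stepArg z = boolPair (fstF z) (boolPair (fstF (fstF (sndF z))) (sndF (sndF z))) := by
      simp [stepArg, nthF, sndPow]
    rw [harg] at hs ⊢
    simp only [fstF_boolPair, sndF_boolPair] at hs
    omega

/-- **The list fold with a polynomially growing step is in `FP`.** [cite: AroraBarak2009, §1.3, §1.4.1] -/
theorem foldFn_mem_FP_of_poly {step ini : List Bool → List Bool} (hstep : step ∈ FP) (hini : ini ∈ FP)
    (G : Polynomial ℕ) (hg : ∀ v, (step v).length ≤ (sndF (sndF v)).length + G.eval (fstF v).length) :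
    foldFn step ini ∈ FP :=
  comp_mem_FP (sndPow_mem_FP 1) (comp_mem_FP
    (iterate_mem_FP_of_growth_poly (foldRound_mem_FP hstep) (G + 4) (fun w => fstF_foldRound step w)
      (fun w => by simpa [fstF] using length_foldRound_le_poly hg w) X)
    (fanoutFn_mem_FP (PolyTimeComputable.id _) (fanoutFn_mem_FP sndF_mem_FP hini)))

/-! ### The context and the accessors of the step argument -/

/-- The context of the printer: `⟨y₂, ⟨1^N, ⟨⟨bin n, bin T⟩, bin N⟩⟩⟩` (`y₂` a padding making the
whole input at least quadratically long). [folklore] -/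
def slotCtx (y2 : List Bool) (n T N : ℕ) : List Bool :=
  boolPair y2 (boolPair (ones N) (boolPair (boolPair (encodeNat n) (encodeNat T)) (encodeNat N)))

/-- Field `1^N` of the context. [folklore] -/
def cY1 : List Bool → List Bool := fstF ∘ sndF
/-- Field `⟨bin n, bin T⟩` of the context. [folklore] -/
def cRho : List Bool → List Bool := fstF ∘ sndF ∘ sndF
/-- Field `bin N` of the context. [folklore] -/
def cN : List Bool → List Bool := sndF ∘ sndF ∘ sndF

/-- Field of the context (`cY1_slotCtx`). [folklore] -/
@[simp] theorem cY1_slotCtx (y2 : List Bool) (n T N : ℕ) : cY1 (slotCtx y2 n T N) = ones N := by simp [cY1, slotCtx]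
/-- Field of the context (`cRho_slotCtx`). [folklore] -/
@[simp] theorem cRho_slotCtx (y2 : List Bool) (n T N : ℕ) :
    cRho (slotCtx y2 n T N) = boolPair (encodeNat n) (encodeNat T) := by simp [cRho, slotCtx]
/-- Field of the context (`cN_slotCtx`). [folklore] -/
@[simp] theorem cN_slotCtx (y2 : List Bool) (n T N : ℕ) : cN (slotCtx y2 n T N) = encodeNat N := by simp [cN, slotCtx]

/-- `cY1 ∈ FP` (composition of bricks). [folklore] -/
theorem cY1_mem_FP : cY1 ∈ FP := comp_mem_FP fstF_mem_FP sndF_mem_FP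
/-- `cRho ∈ FP` (composition of bricks). [folklore] -/
theorem cRho_mem_FP : cRho ∈ FP := comp_mem_FP fstF_mem_FP (comp_mem_FP sndF_mem_FP sndF_mem_FP)
/-- `cN ∈ FP` (composition of bricks). [folklore] -/
theorem cN_mem_FP : cN ∈ FP := comp_mem_FP sndF_mem_FP (comp_mem_FP sndF_mem_FP sndF_mem_FP)

/-- The step argument is `v = ⟨w, ⟨code, acc⟩⟩` with `w = ⟨ctx, L⟩`: its context. [folklore] -/
def vCtx : List Bool → List Bool := fstF ∘ fstF
/-- The gate code being processed. [folklore] -/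
def vCode : List Bool → List Bool := fstF ∘ sndF
/-- The emitted part of the accumulator. [folklore] -/
def vEm : List Bool → List Bool := sndF ∘ sndF ∘ sndF
/-- The counter numeral of the accumulator, clipped to `|w| + 1` symbols. [folklore] -/
def vK : List Bool → List Bool := clipF 1 (fstF ∘ sndF ∘ sndF)

/-- `vCtx ∈ FP` (composition of bricks). [folklore] -/
theorem vCtx_mem_FP : vCtx ∈ FP := comp_mem_FP fstF_mem_FP fstF_mem_FP
/-- `vCode ∈ FP` (composition of bricks). [folklore] -/
theorem vCode_mem_FP : vCode ∈ FP := comp_mem_FP fstF_mem_FP sndF_mem_FP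
/-- `vEm ∈ FP` (composition of bricks). [folklore] -/
theorem vEm_mem_FP : vEm ∈ FP := comp_mem_FP sndF_mem_FP (comp_mem_FP sndF_mem_FP sndF_mem_FP)
/-- `vK ∈ FP` (composition of bricks). [folklore] -/
theorem vK_mem_FP : vK ∈ FP := clipF_mem_FP 1 (comp_mem_FP fstF_mem_FP (comp_mem_FP sndF_mem_FP sndF_mem_FP))

/-- The code without its tag bit. [folklore] -/
def restF : List Bool → List Bool := Plumb.dropFn ∘ fanoutFn (fun _ => [true]) id
/-- The numeral of the first wire of a gate code. [folklore] -/
def w0F : List Bool → List Bool := fstF ∘ sndF ∘ sndF ∘ restF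
/-- The numeral of the second wire of a gate code. [folklore] -/
def w1F : List Bool → List Bool := fstF ∘ sndF ∘ sndF ∘ sndF ∘ restF

/-- `restF ∈ FP` (composition of bricks). [folklore] -/
theorem restF_mem_FP : restF ∈ FP :=
  comp_mem_FP Plumb.dropFn_mem_FP (fanoutFn_mem_FP (const_mem_FP _) (PolyTimeComputable.id _))
/-- `w0F ∈ FP` (composition of bricks). [folklore] -/
theorem w0F_mem_FP : w0F ∈ FP := comp_mem_FP fstF_mem_FP (comp_mem_FP sndF_mem_FP (comp_mem_FP sndF_mem_FP restF_mem_FP))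
/-- `w1F ∈ FP` (composition of bricks). [folklore] -/
theorem w1F_mem_FP : w1F ∈ FP :=
  comp_mem_FP fstF_mem_FP (comp_mem_FP sndF_mem_FP (comp_mem_FP sndF_mem_FP (comp_mem_FP sndF_mem_FP restF_mem_FP)))

/-- The list code of naturals, unfolded. [folklore] -/
theorem encodingListNatBool_encode (l : List ℕ) :
    encodingListNatBool.encode l = boolPair (unaryEncodeNat l.length) (l.foldr (fun a acc => boolPair (encodeNat a) acc) []) :=
  rfl

/-- The code of a placed `H` without its tag bit. [folklore] -/
theorem encode_gateH {N : ℕ} (e : Fin (cliffordT.arity CliffordTOp.H) ↪ Fin N) :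
    (QGate.gate CliffordTOp.H e : QGate cliffordT N).encode =
      false :: boolPair (encodeNat 0) (boolPair [true] (boolPair (encodeNat (embH e 0 : ℕ)) [])) := by
  rw [encode_eq_tag_cons]
  change false :: boolPair (encodeNat 0) (encodingListNatBool.encode (List.ofFn fun i : Fin 1 => ((embH e) i : ℕ))) = _
  simp [encodingListNatBool_encode, List.ofFn_succ, unaryEncodeNat]

/-- The code of a placed `S` without its tag bit. [folklore] -/
theorem encode_gateS {N : ℕ} (e : Fin (cliffordT.arity CliffordTOp.S) ↪ Fin N) :
    (QGate.gate CliffordTOp.S e : QGate cliffordT N).encode =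
      false :: boolPair (encodeNat 1) (boolPair [true] (boolPair (encodeNat (embS e 0 : ℕ)) [])) := by
  rw [encode_eq_tag_cons]
  change false :: boolPair (encodeNat 1) (encodingListNatBool.encode (List.ofFn fun i : Fin 1 => ((embS e) i : ℕ))) = _
  simp [encodingListNatBool_encode, List.ofFn_succ, unaryEncodeNat]

/-- The code of a placed `T` without its tag bit. [folklore] -/
theorem encode_gateT {N : ℕ} (e : Fin (cliffordT.arity CliffordTOp.T) ↪ Fin N) :
    (QGate.gate CliffordTOp.T e : QGate cliffordT N).encode =
      false :: boolPair (encodeNat 2) (boolPair [true] (boolPair (encodeNat (embT e 0 : ℕ)) [])) := by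
  rw [encode_eq_tag_cons]
  change false :: boolPair (encodeNat 2) (encodingListNatBool.encode (List.ofFn fun i : Fin 1 => ((embT e) i : ℕ))) = _
  simp [encodingListNatBool_encode, List.ofFn_succ, unaryEncodeNat]

/-- The code of a placed `CNOT`. [folklore] -/
theorem encode_gateCNOT {N : ℕ} (e : Fin (cliffordT.arity CliffordTOp.CNOT) ↪ Fin N) :
    (QGate.gate CliffordTOp.CNOT e : QGate cliffordT N).encode =
      false :: boolPair (encodeNat 3) (boolPair [true, true]
        (boolPair (encodeNat (embC e 0 : ℕ)) (boolPair (encodeNat (embC e 1 : ℕ)) []))) := by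
  rw [encode_eq_tag_cons]
  change false :: boolPair (encodeNat 3) (encodingListNatBool.encode (List.ofFn fun i : Fin 2 => ((embC e) i : ℕ))) = _
  simp [encodingListNatBool_encode, List.ofFn_succ, unaryEncodeNat]

/-- `restF` drops the tag bit. [folklore] -/
@[simp] theorem restF_cons (b : Bool) (c : List Bool) : restF (b :: c) = c := by
  simp [restF]

/-- First wire of `H`. [folklore] -/
theorem w0F_encode_H {N : ℕ} (e : Fin (cliffordT.arity CliffordTOp.H) ↪ Fin N) :
    w0F (QGate.gate CliffordTOp.H e : QGate cliffordT N).encode = encodeNat (embH e 0 : ℕ) := by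
  rw [encode_gateH]; simp [w0F]
/-- First wire of `S`. [folklore] -/
theorem w0F_encode_S {N : ℕ} (e : Fin (cliffordT.arity CliffordTOp.S) ↪ Fin N) :
    w0F (QGate.gate CliffordTOp.S e : QGate cliffordT N).encode = encodeNat (embS e 0 : ℕ) := by
  rw [encode_gateS]; simp [w0F]
/-- First wire of `T`. [folklore] -/
theorem w0F_encode_T {N : ℕ} (e : Fin (cliffordT.arity CliffordTOp.T) ↪ Fin N) :
    w0F (QGate.gate CliffordTOp.T e : QGate cliffordT N).encode = encodeNat (embT e 0 : ℕ) := by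
  rw [encode_gateT]; simp [w0F]
/-- Control wire of `CNOT`. [folklore] -/
theorem w0F_encode_CNOT {N : ℕ} (e : Fin (cliffordT.arity CliffordTOp.CNOT) ↪ Fin N) :
    w0F (QGate.gate CliffordTOp.CNOT e : QGate cliffordT N).encode = encodeNat (embC e 0 : ℕ) := by
  rw [encode_gateCNOT]; simp [w0F]
/-- Target wire of `CNOT`. [folklore] -/
theorem w1F_encode_CNOT {N : ℕ} (e : Fin (cliffordT.arity CliffordTOp.CNOT) ↪ Fin N) :
    w1F (QGate.gate CliffordTOp.CNOT e : QGate cliffordT N).encode = encodeNat (embC e 1 : ℕ) := by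
  rw [encode_gateCNOT]; simp [w1F]

/-- The first-wire numeral, clipped to `|w| + 1` symbols. [folklore] -/
def vW0 : List Bool → List Bool := clipF 1 (w0F ∘ vCode)
/-- The second-wire numeral, clipped. [folklore] -/
def vW1 : List Bool → List Bool := clipF 1 (w1F ∘ vCode)

/-- `vW0 ∈ FP` (composition of bricks). [folklore] -/
theorem vW0_mem_FP : vW0 ∈ FP := clipF_mem_FP 1 (comp_mem_FP w0F_mem_FP vCode_mem_FP)
/-- `vW1 ∈ FP` (composition of bricks). [folklore] -/
theorem vW1_mem_FP : vW1 ∈ FP := clipF_mem_FP 1 (comp_mem_FP w1F_mem_FP vCode_mem_FP)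

/-! ### Derived numerals -/

/-- `bin (k + a)`. [folklore] -/
def kA : List Bool → List Bool := addFn ∘ fanoutFn vK vW0
/-- `bin (k + b)` (`b` the second wire). [folklore] -/
def kB : List Bool → List Bool := addFn ∘ fanoutFn vK vW1
/-- `bin (N + k)`. [folklore] -/
def nk : List Bool → List Bool := addFn ∘ fanoutFn (cN ∘ vCtx) vK
/-- `bin (N + k + 1)`. [folklore] -/
def nk1 : List Bool → List Bool := succN ∘ nk
/-- `bin (extra g)`. [folklore] -/
def eB : List Bool → List Bool := lenBinF ∘ extraU ∘ vCode
/-- `bin (N + k + e)`, the base of the first layer's targets. [folklore] -/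
def bB : List Bool → List Bool := addFn ∘ fanoutFn nk eB
/-- `bin (N + k + e + N)`, the base of the second layer's targets = the new counter. [folklore] -/
def b2B : List Bool → List Bool := addFn ∘ fanoutFn bB (cN ∘ vCtx)
/-- The relabelling context. [folklore] -/
def rCtx : List Bool → List Bool := cRho ∘ vCtx

/-- `kA ∈ FP` (composition of bricks). [folklore] -/
theorem kA_mem_FP : kA ∈ FP := comp_mem_FP addFn_mem_FP (fanoutFn_mem_FP vK_mem_FP vW0_mem_FP)
/-- `kB ∈ FP` (composition of bricks). [folklore] -/
theorem kB_mem_FP : kB ∈ FP := comp_mem_FP addFn_mem_FP (fanoutFn_mem_FP vK_mem_FP vW1_mem_FP)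
/-- `nk ∈ FP` (composition of bricks). [folklore] -/
theorem nk_mem_FP : nk ∈ FP := comp_mem_FP addFn_mem_FP (fanoutFn_mem_FP (comp_mem_FP cN_mem_FP vCtx_mem_FP) vK_mem_FP)
/-- `nk1 ∈ FP` (composition of bricks). [folklore] -/
theorem nk1_mem_FP : nk1 ∈ FP := comp_mem_FP succN_mem_FP nk_mem_FP
/-- `eB ∈ FP` (composition of bricks). [folklore] -/
theorem eB_mem_FP : eB ∈ FP := comp_mem_FP lenBinF_mem_FP (comp_mem_FP extraU_mem_FP vCode_mem_FP)
/-- `bB ∈ FP` (composition of bricks). [folklore] -/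
theorem bB_mem_FP : bB ∈ FP := comp_mem_FP addFn_mem_FP (fanoutFn_mem_FP nk_mem_FP eB_mem_FP)
/-- `b2B ∈ FP` (composition of bricks). [folklore] -/
theorem b2B_mem_FP : b2B ∈ FP := comp_mem_FP addFn_mem_FP (fanoutFn_mem_FP bB_mem_FP (comp_mem_FP cN_mem_FP vCtx_mem_FP))
/-- `rCtx ∈ FP` (composition of bricks). [folklore] -/
theorem rCtx_mem_FP : rCtx ∈ FP := comp_mem_FP cRho_mem_FP vCtx_mem_FP

/-! ### The gate's own blocks -/

/-- `⟨code of CZ (ρ(k+a)) (ρ(N+k)), ε⟩` (the `H` gadget). [folklore] -/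
def gH : List Bool → List Bool := czBlockF ∘ fanoutFn rCtx (fanoutFn kA nk)
/-- `⟨code of T (ρ(k+a)), ε⟩`. [folklore] -/
def gT : List Bool → List Bool := tBlockF ∘ fanoutFn rCtx kA
/-- `S = T T`. [folklore] -/
def gS : List Bool → List Bool := fun v => gT v ++ gT v
/-- The first `CZ` of the `CNOT` gadget: `CZ (ρ(k+b)) (ρ(N+k))`. [folklore] -/
def gC1 : List Bool → List Bool := czBlockF ∘ fanoutFn rCtx (fanoutFn kB nk)
/-- The last `CZ` of the `CNOT` gadget: `CZ (ρ(N+k)) (ρ(N+k+1))`. [folklore] -/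
def gC3 : List Bool → List Bool := czBlockF ∘ fanoutFn rCtx (fanoutFn nk nk1)
/-- `CNOT = H_b CZ H_b`. [folklore] -/
def gC : List Bool → List Bool := fun v => gC1 v ++ (gH v ++ gC3 v)

/-- The symbol tests on the step argument. [folklore] -/
def isSym (i : ℕ) : List Bool → List Bool := symIsF i ∘ vCode

/-- One-bit output (`oneBit_isSym`). [folklore] -/
theorem oneBit_isSym (i : ℕ) : OneBit (isSym i) := (oneBit_symIsF i).comp _
/-- `isSym ∈ FP` (composition of bricks). [folklore] -/
theorem isSym_mem_FP (i : ℕ) : isSym i ∈ FP := comp_mem_FP (symIsF_mem_FP i) vCode_mem_FP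

/-- **The gate's own blocks**, by a branch on the symbol (`H`, `S`, `T`, `CNOT`; nothing else).
[cite: BremnerJozsaShepherdPRSA2011, Thm. 1 (proof)] -/
def gateBlocks : List Bool → List Bool :=
  iteFn (isSym 0) gH (iteFn (isSym 1) gS (iteFn (isSym 2) gT (iteFn (isSym 3) gC fun _ => [])))

/-- `gH ∈ FP` (composition of bricks). [folklore] -/
theorem gH_mem_FP : gH ∈ FP := comp_mem_FP czBlockF_mem_FP (fanoutFn_mem_FP rCtx_mem_FP (fanoutFn_mem_FP kA_mem_FP nk_mem_FP))
/-- `gT ∈ FP` (composition of bricks). [folklore] -/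
theorem gT_mem_FP : gT ∈ FP := comp_mem_FP tBlockF_mem_FP (fanoutFn_mem_FP rCtx_mem_FP kA_mem_FP)
/-- `gS ∈ FP` (composition of bricks). [folklore] -/
theorem gS_mem_FP : gS ∈ FP := append_mem_FP gT_mem_FP gT_mem_FP
/-- `gC1 ∈ FP` (composition of bricks). [folklore] -/
theorem gC1_mem_FP : gC1 ∈ FP := comp_mem_FP czBlockF_mem_FP (fanoutFn_mem_FP rCtx_mem_FP (fanoutFn_mem_FP kB_mem_FP nk_mem_FP))
/-- `gC3 ∈ FP` (composition of bricks). [folklore] -/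
theorem gC3_mem_FP : gC3 ∈ FP := comp_mem_FP czBlockF_mem_FP (fanoutFn_mem_FP rCtx_mem_FP (fanoutFn_mem_FP nk_mem_FP nk1_mem_FP))
/-- `gC ∈ FP` (composition of bricks). [folklore] -/
theorem gC_mem_FP : gC ∈ FP := append_mem_FP gC1_mem_FP (append_mem_FP gH_mem_FP gC3_mem_FP)
/-- `gateBlocks ∈ FP` (composition of bricks). [folklore] -/
theorem gateBlocks_mem_FP : gateBlocks ∈ FP :=
  iteFn_mem_FP (isSym_mem_FP 0) gH_mem_FP (iteFn_mem_FP (isSym_mem_FP 1) gS_mem_FP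
    (iteFn_mem_FP (isSym_mem_FP 2) gT_mem_FP (iteFn_mem_FP (isSym_mem_FP 3) gC_mem_FP (const_mem_FP _))))

/-! ### The two layers -/

/-- The exceptional wire of the first layer: `a` for `H`, `b` for `CNOT`, `N` (none) otherwise. [folklore] -/
def tSel : List Bool → List Bool := iteFn (isSym 0) (canonN ∘ vW0) (iteFn (isSym 3) (canonN ∘ vW1) (cN ∘ vCtx))
/-- Its source: `N + k` for `H`, `N + k + 1` for `CNOT`, `0` otherwise. [folklore] -/
def sSel : List Bool → List Bool := iteFn (isSym 0) nk (iteFn (isSym 3) nk1 fun _ => encodeNat 0)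

/-- `tSel ∈ FP` (composition of bricks). [folklore] -/
theorem tSel_mem_FP : tSel ∈ FP :=
  iteFn_mem_FP (isSym_mem_FP 0) (comp_mem_FP canonN_mem_FP vW0_mem_FP)
    (iteFn_mem_FP (isSym_mem_FP 3) (comp_mem_FP canonN_mem_FP vW1_mem_FP) (comp_mem_FP cN_mem_FP vCtx_mem_FP))
/-- `sSel ∈ FP` (composition of bricks). [folklore] -/
theorem sSel_mem_FP : sSel ∈ FP :=
  iteFn_mem_FP (isSym_mem_FP 0) nk_mem_FP (iteFn_mem_FP (isSym_mem_FP 3) nk1_mem_FP (const_mem_FP _))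

/-- The context of the first layer: `layerCtx 1^N n T N k (N+k+e) t s`. [folklore] -/
def ctx1 : List Bool → List Bool :=
  fanoutFn (cY1 ∘ vCtx) (fanoutFn rCtx (fanoutFn (cN ∘ vCtx) (fanoutFn vK (fanoutFn bB (fanoutFn tSel sSel)))))
/-- The context of the second layer: `layerCtx 1^N n T N (N+k+e) (N+k+e+N) N 0`. [folklore] -/
def ctx2 : List Bool → List Bool :=
  fanoutFn (cY1 ∘ vCtx) (fanoutFn rCtx (fanoutFn (cN ∘ vCtx) (fanoutFn bB (fanoutFn b2B
    (fanoutFn (cN ∘ vCtx) fun _ => encodeNat 0)))))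

/-- `ctx1 ∈ FP` (composition of bricks). [folklore] -/
theorem ctx1_mem_FP : ctx1 ∈ FP :=
  fanoutFn_mem_FP (comp_mem_FP cY1_mem_FP vCtx_mem_FP) (fanoutFn_mem_FP rCtx_mem_FP (fanoutFn_mem_FP
    (comp_mem_FP cN_mem_FP vCtx_mem_FP) (fanoutFn_mem_FP vK_mem_FP (fanoutFn_mem_FP bB_mem_FP
      (fanoutFn_mem_FP tSel_mem_FP sSel_mem_FP)))))
/-- `ctx2 ∈ FP` (composition of bricks). [folklore] -/
theorem ctx2_mem_FP : ctx2 ∈ FP :=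
  fanoutFn_mem_FP (comp_mem_FP cY1_mem_FP vCtx_mem_FP) (fanoutFn_mem_FP rCtx_mem_FP (fanoutFn_mem_FP
    (comp_mem_FP cN_mem_FP vCtx_mem_FP) (fanoutFn_mem_FP bB_mem_FP (fanoutFn_mem_FP b2B_mem_FP
      (fanoutFn_mem_FP (comp_mem_FP cN_mem_FP vCtx_mem_FP) (const_mem_FP _))))))

/-! ### The step -/

/-- **The slot step of the description printer**: new counter `N + k + e + N`, and the emitted
string extended by the gate's blocks and the two layers.
[cite: BremnerJozsaShepherdPRSA2011, Thm. 1 (proof)] -/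
def slotStep : List Bool → List Bool := fanoutFn b2B emitF
where
  /-- The two layers. [folklore] -/
  layersF : List Bool → List Bool := appF ∘ fanoutFn (layerF ∘ ctx1) (layerF ∘ ctx2)
  /-- The emitted string after the slot: old emissions, gate blocks, two layers. [folklore] -/
  emitF : List Bool → List Bool := appF ∘ fanoutFn vEm (appF ∘ fanoutFn gateBlocks layersF)

/-- The two layers of a slot are in `FP`. [folklore] -/
theorem layersF_mem_FP : slotStep.layersF ∈ FP :=
  comp_mem_FP appF_mem_FP (fanoutFn_mem_FP (comp_mem_FP layerF_mem_FP ctx1_mem_FP) (comp_mem_FP layerF_mem_FP ctx2_mem_FP))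

/-- `slotStep.emitF ∈ FP`. [folklore] -/
theorem emitF_mem_FP : slotStep.emitF ∈ FP :=
  comp_mem_FP appF_mem_FP (fanoutFn_mem_FP vEm_mem_FP (comp_mem_FP appF_mem_FP (fanoutFn_mem_FP gateBlocks_mem_FP layersF_mem_FP)))

/-- `slotStep ∈ FP`. [cite: AroraBarak2009, §1.3] -/
theorem slotStep_mem_FP : slotStep ∈ FP := fanoutFn_mem_FP b2B_mem_FP emitF_mem_FP

/-- `slotStep` unfolded on an argument. [folklore] -/
theorem slotStep_eq (v : List Bool) :
    slotStep v = boolPair (b2B v) (vEm v ++ (gateBlocks v ++ (layerF (ctx1 v) ++ layerF (ctx2 v)))) := by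
  simp [slotStep, slotStep.emitF, slotStep.layersF, fanoutFn_apply, appF]

/-! ### Value of the step on a genuine argument -/

section Value

variable {N : ℕ} (y2 L : List Bool) (n T : ℕ) (g : QGate cliffordT N) (k : ℕ) (em : List Bool)

/-- The genuine step argument. [folklore] -/
def vArg : List Bool :=
  boolPair (boolPair (slotCtx y2 n T N) L) (boolPair g.encode (boolPair (encodeNat k) em))

variable {y2 L n T g k em}

/-- Value on a genuine step argument (`vCtx_vArg`). [folklore] -/
theorem vCtx_vArg : vCtx (vArg y2 L n T g k em) = slotCtx y2 n T N := by simp [vCtx, vArg]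
/-- Value on a genuine step argument (`vCode_vArg`). [folklore] -/
theorem vCode_vArg : vCode (vArg y2 L n T g k em) = g.encode := by simp [vCode, vArg]
/-- Value on a genuine step argument (`vEm_vArg`). [folklore] -/
theorem vEm_vArg : vEm (vArg y2 L n T g k em) = em := by simp [vEm, vArg]
/-- Value on a genuine step argument (`fstF_vArg`). [folklore] -/
theorem fstF_vArg : fstF (vArg y2 L n T g k em) = boolPair (slotCtx y2 n T N) L := by simp [vArg]
/-- Value on a genuine step argument (`rCtx_vArg`). [folklore] -/
theorem rCtx_vArg : rCtx (vArg y2 L n T g k em) = boolPair (encodeNat n) (encodeNat T) := by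
  simp [rCtx, vCtx_vArg]
/-- Value on a genuine step argument (`cN_vCtx_vArg`). [folklore] -/
theorem cN_vCtx_vArg : cN (vCtx (vArg y2 L n T g k em)) = encodeNat N := by simp [vCtx_vArg]
/-- Value on a genuine step argument (`cY1_vCtx_vArg`). [folklore] -/
theorem cY1_vCtx_vArg : cY1 (vCtx (vArg y2 L n T g k em)) = ones N := by simp [vCtx_vArg]

/-- The clipped counter is the counter when it fits. [folklore] -/
theorem vK_vArg (hk : (encodeNat k).length ≤ (boolPair (slotCtx y2 n T N) L).length + 1) :
    vK (vArg y2 L n T g k em) = encodeNat k := by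
  rw [vK, clipF_apply, fstF_vArg, one_mul]
  simp only [Function.comp_apply, vArg, sndF_boolPair, fstF_boolPair]
  exact List.take_of_length_le hk

/-- Value on a genuine step argument (`isSym_vArg`). [folklore] -/
theorem isSym_vArg (i : ℕ) : isSym i (vArg y2 L n T g k em) = [decide (symIdx g = i)] := by
  simp [isSym, vCode_vArg, symIsF_encode]

/-- Value on a genuine step argument (`eB_vArg`). [folklore] -/
theorem eB_vArg (g' : CliffordTOp) (e : Fin (cliffordT.arity g') ↪ Fin N) (hg : g = QGate.gate g' e) :
    eB (vArg y2 L n T g k em) = encodeNat (extra g) := by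
  subst hg
  simp [eB, vCode_vArg, extraU_encode_gate]

variable (hk : (encodeNat k).length ≤ (boolPair (slotCtx y2 n T N) L).length + 1)
include hk

/-- Value on a genuine step argument (`nk_vArg`). [folklore] -/
theorem nk_vArg : nk (vArg y2 L n T g k em) = encodeNat (N + k) := by
  simp [nk, fanoutFn_apply, Function.comp_apply, cN_vCtx_vArg, vK_vArg hk]

/-- Value on a genuine step argument (`nk1_vArg`). [folklore] -/
theorem nk1_vArg : nk1 (vArg y2 L n T g k em) = encodeNat (N + k + 1) := by
  simp [nk1, nk_vArg hk]

/-- Value on a genuine step argument (`bB_vArg`). [folklore] -/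
theorem bB_vArg (g' : CliffordTOp) (e : Fin (cliffordT.arity g') ↪ Fin N) (hg : g = QGate.gate g' e) :
    bB (vArg y2 L n T g k em) = encodeNat (N + k + extra g) := by
  simp [bB, fanoutFn_apply, nk_vArg hk, eB_vArg g' e hg]

/-- Value on a genuine step argument (`b2B_vArg`). [folklore] -/
theorem b2B_vArg (g' : CliffordTOp) (e : Fin (cliffordT.arity g') ↪ Fin N) (hg : g = QGate.gate g' e) :
    b2B (vArg y2 L n T g k em) = encodeNat (N + k + extra g + N) := by
  simp [b2B, fanoutFn_apply, Function.comp_apply, bB_vArg hk g' e hg, cN_vCtx_vArg]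

omit hk in
/-- The clipped wire numerals are the wire numerals when the code fits. [folklore] -/
theorem vW0_vArg_of {a : ℕ} (h0 : w0F g.encode = encodeNat a) (ha : (encodeNat a).length ≤ (boolPair (slotCtx y2 n T N) L).length + 1) :
    vW0 (vArg y2 L n T g k em) = encodeNat a := by
  rw [vW0, clipF_apply, fstF_vArg, one_mul, Function.comp_apply, vCode_vArg, h0]
  exact List.take_of_length_le ha

omit hk in
/-- Value on a genuine step argument (`vW1_vArg_of`). [folklore] -/
theorem vW1_vArg_of {b : ℕ} (h1 : w1F g.encode = encodeNat b) (hb : (encodeNat b).length ≤ (boolPair (slotCtx y2 n T N) L).length + 1) :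
    vW1 (vArg y2 L n T g k em) = encodeNat b := by
  rw [vW1, clipF_apply, fstF_vArg, one_mul, Function.comp_apply, vCode_vArg, h1]
  exact List.take_of_length_le hb

/-- Value on a genuine step argument (`kA_vArg_of`). [folklore] -/
theorem kA_vArg_of {a : ℕ} (h0 : w0F g.encode = encodeNat a) (ha : (encodeNat a).length ≤ (boolPair (slotCtx y2 n T N) L).length + 1) :
    kA (vArg y2 L n T g k em) = encodeNat (k + a) := by
  simp [kA, fanoutFn_apply, vK_vArg hk, vW0_vArg_of h0 ha]

/-- Value on a genuine step argument (`kB_vArg_of`). [folklore] -/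
theorem kB_vArg_of {b : ℕ} (h1 : w1F g.encode = encodeNat b) (hb : (encodeNat b).length ≤ (boolPair (slotCtx y2 n T N) L).length + 1) :
    kB (vArg y2 L n T g k em) = encodeNat (k + b) := by
  simp [kB, fanoutFn_apply, vK_vArg hk, vW1_vArg_of h1 hb]

/-- The second layer's context. [folklore] -/
theorem ctx2_vArg (g' : CliffordTOp) (e : Fin (cliffordT.arity g') ↪ Fin N) (hg : g = QGate.gate g' e) :
    ctx2 (vArg y2 L n T g k em) = layerCtx (ones N) n T N (N + k + extra g) (N + k + extra g + N) N 0 := by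
  have h1 := cY1_vCtx_vArg (y2 := y2) (L := L) (n := n) (T := T) (g := g) (k := k) (em := em)
  have h2 := rCtx_vArg (y2 := y2) (L := L) (n := n) (T := T) (g := g) (k := k) (em := em)
  have h3 := cN_vCtx_vArg (y2 := y2) (L := L) (n := n) (T := T) (g := g) (k := k) (em := em)
  have h4 := bB_vArg hk g' e hg (em := em)
  have h5 := b2B_vArg hk g' e hg (em := em)
  simp only [ctx2, fanoutFn_apply, Function.comp_apply]
  rw [h1, h2, h3, h4, h5]
  rfl

/-- The second layer. [folklore] -/
theorem layer2_vArg (g' : CliffordTOp) (e : Fin (cliffordT.arity g') ↪ Fin N) (hg : g = QGate.gate g' e) :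
    layerF (ctx2 (vArg y2 L n T g k em)) = encList (List.ofFn fun a : Fin N =>
      opCode ((DOp.CZ (N + (k + extra g) + a) (N + (k + extra g + N) + a)).map (rho n T))) := by
  have hN : N ≤ (ones N).length := by rw [List.length_replicate]
  rw [ctx2_vArg hk g' e hg]
  rw [layerF_apply (ones N) n T N (N + k + extra g) (N + k + extra g + N) N 0 hN]
  refine congrArg encList (congrArg List.ofFn (funext fun a => ?_))
  rw [if_neg (Nat.ne_of_lt a.isLt)]
  have e1 : N + k + extra g + (a : ℕ) = N + (k + extra g) + a := by omega
  have e2 : N + k + extra g + N + (a : ℕ) = N + (k + extra g + N) + a := by omega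
  rw [e1, e2]

omit hk in
/-- The wire numeral of an `H` is shorter than its code. [folklore] -/
theorem length_wire_le_H (e : Fin (cliffordT.arity CliffordTOp.H) ↪ Fin N) :
    (encodeNat (embH e 0 : ℕ)).length ≤ (QGate.gate CliffordTOp.H e : QGate cliffordT N).encode.length := by
  rw [encode_gateH]; simp only [List.length_cons, length_boolPair, List.length_nil]; omega

omit hk in
/-- The wire numeral of an `S` is shorter than its code. [folklore] -/
theorem length_wire_le_S (e : Fin (cliffordT.arity CliffordTOp.S) ↪ Fin N) :
    (encodeNat (embS e 0 : ℕ)).length ≤ (QGate.gate CliffordTOp.S e : QGate cliffordT N).encode.length := by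
  rw [encode_gateS]; simp only [List.length_cons, length_boolPair, List.length_nil]; omega

omit hk in
/-- The wire numeral of a `T` is shorter than its code. [folklore] -/
theorem length_wire_le_T (e : Fin (cliffordT.arity CliffordTOp.T) ↪ Fin N) :
    (encodeNat (embT e 0 : ℕ)).length ≤ (QGate.gate CliffordTOp.T e : QGate cliffordT N).encode.length := by
  rw [encode_gateT]; simp only [List.length_cons, length_boolPair, List.length_nil]; omega

omit hk in
/-- The wire numerals of a `CNOT` are shorter than its code. [folklore] -/
theorem length_wires_le_CNOT (e : Fin (cliffordT.arity CliffordTOp.CNOT) ↪ Fin N) :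
    (encodeNat (embC e 0 : ℕ)).length ≤ (QGate.gate CliffordTOp.CNOT e : QGate cliffordT N).encode.length ∧
      (encodeNat (embC e 1 : ℕ)).length ≤ (QGate.gate CliffordTOp.CNOT e : QGate cliffordT N).encode.length := by
  rw [encode_gateCNOT]; simp only [List.length_cons, length_boolPair, List.length_nil]; omega

/-- The first layer's context, given the exceptional wire and its source. [folklore] -/
theorem ctx1_vArg_of (g' : CliffordTOp) (e : Fin (cliffordT.arity g') ↪ Fin N) (hg : g = QGate.gate g' e) {t s : ℕ}
    (ht : tSel (vArg y2 L n T g k em) = encodeNat t) (hs : sSel (vArg y2 L n T g k em) = encodeNat s) :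
    ctx1 (vArg y2 L n T g k em) = layerCtx (ones N) n T N k (N + k + extra g) t s := by
  have h1 := cY1_vCtx_vArg (y2 := y2) (L := L) (n := n) (T := T) (g := g) (k := k) (em := em)
  have h2 := rCtx_vArg (y2 := y2) (L := L) (n := n) (T := T) (g := g) (k := k) (em := em)
  have h3 := cN_vCtx_vArg (y2 := y2) (L := L) (n := n) (T := T) (g := g) (k := k) (em := em)
  have h4 := bB_vArg hk g' e hg (em := em)
  have h6 := vK_vArg hk (g := g) (em := em)
  simp only [ctx1, fanoutFn_apply, Function.comp_apply]
  rw [h1, h2, h3, h4, h6, ht, hs]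
  rfl

/-- The first layer, given the exceptional wire and its source. [folklore] -/
theorem layer1_vArg_of (g' : CliffordTOp) (e : Fin (cliffordT.arity g') ↪ Fin N) (hg : g = QGate.gate g' e) {t s : ℕ}
    (ht : tSel (vArg y2 L n T g k em) = encodeNat t) (hs : sSel (vArg y2 L n T g k em) = encodeNat s)
    (hcur : ∀ a : Fin N, gateCur N k g a = if (a : ℕ) = t then s else k + a) :
    layerF (ctx1 (vArg y2 L n T g k em)) = encList (List.ofFn fun a : Fin N =>
      opCode ((DOp.CZ (gateCur N k g a) (N + (k + extra g) + a)).map (rho n T))) := by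
  have hN : N ≤ (ones N).length := by rw [List.length_replicate]
  rw [ctx1_vArg_of hk g' e hg ht hs]
  rw [layerF_apply (ones N) n T N k (N + k + extra g) t s hN]
  refine congrArg encList (congrArg List.ofFn (funext fun a => ?_))
  rw [hcur a]
  have e2 : N + k + extra g + (a : ℕ) = N + (k + extra g) + a := by omega
  rw [e2]

omit hk in
/-- The emitted part of a slot splits as gate, first layer, second layer. [folklore] -/
theorem encList_slotOps :
    encList ((slotOps N k g).map fun op => opCode (op.map (rho n T))) =
      encList ((gateOps N k g).map fun op => opCode (op.map (rho n T))) ++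
        (encList (List.ofFn fun a : Fin N => opCode ((DOp.CZ (gateCur N k g a) (N + (k + extra g) + a)).map (rho n T))) ++
          encList (List.ofFn fun a : Fin N =>
            opCode ((DOp.CZ (N + (k + extra g) + a) (N + (k + extra g + N) + a)).map (rho n T)))) := by
  rw [slotOps, List.map_append, List.map_append, encList_append', encList_append', List.map_ofFn, List.map_ofFn,
    List.append_assoc]
  rfl

omit hk in
/-- On a genuine argument, the symbol tests. [folklore] -/
theorem isSym_vArg_eq (i : ℕ) :
    (isSym i (vArg y2 L n T g k em) = [true]) ↔ symIdx g = i := by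
  rw [isSym_vArg]; exact singleton_decide_eq_iff _

/-- **Value of the slot step on a genuine argument.** [cite: BremnerJozsaShepherdPRSA2011, Thm. 1 (proof)] -/
theorem slotStep_vArg (hg : g.IsOracleFree)
    (hcode : g.encode.length ≤ (boolPair (slotCtx y2 n T N) L).length + 1) :
    slotStep (vArg y2 L n T g k em) =
      boolPair (encodeNat (N + k + extra g + N)) (em ++ encList ((slotOps N k g).map fun op => opCode (op.map (rho n T)))) := by
  obtain ⟨g', e, rfl⟩ : ∃ g' e, g = QGate.gate g' e := by
    cases g with
    | gate g' e => exact ⟨g', e, rfl⟩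
    | oracle k e => exact absurd hg id
  set v := vArg y2 L n T (QGate.gate g' e : QGate cliffordT N) k em with hv
  have hrC := rCtx_vArg (y2 := y2) (L := L) (n := n) (T := T) (g := (QGate.gate g' e : QGate cliffordT N)) (k := k) (em := em)
  have hnk := nk_vArg hk (g := (QGate.gate g' e : QGate cliffordT N)) (em := em)
  have hnk1 := nk1_vArg hk (g := (QGate.gate g' e : QGate cliffordT N)) (em := em)
  have hcN := cN_vCtx_vArg (y2 := y2) (L := L) (n := n) (T := T) (g := (QGate.gate g' e : QGate cliffordT N)) (k := k) (em := em)
  have hS := fun i => isSym_vArg_eq (y2 := y2) (L := L) (n := n) (T := T) (g := (QGate.gate g' e : QGate cliffordT N))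
    (k := k) (em := em) i
  rw [slotStep_eq, b2B_vArg hk g' e rfl, vEm_vArg, encList_slotOps, layer2_vArg hk g' e rfl]
  rw [← hv] at hrC hnk hnk1 hcN hS
  -- it remains to evaluate the gate's own blocks and the first layer, by symbol
  cases g' with
  | H =>
    have h0 : w0F (QGate.gate CliffordTOp.H e : QGate cliffordT N).encode = encodeNat (embH e 0 : ℕ) := w0F_encode_H e
    have ha0 := (length_wire_le_H (N := N) e).trans hcode
    have hkA := kA_vArg_of hk h0 ha0 (em := em)
    rw [← hv] at hkA
    have hGB : gateBlocks v = boolPair (opCode ((DOp.CZ (k + (embH e 0 : ℕ)) (N + k)).map (rho n T))) [] := by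
      rw [gateBlocks, iteFn_of_oneBit (oneBit_isSym 0), if_pos ((hS 0).2 rfl)]
      simp only [gH, Function.comp_apply, fanoutFn_apply, hrC, hkA, hnk, czBlockF_apply, bitsToNat_encodeNat]
    have hT : tSel v = encodeNat (embH e 0 : ℕ) := by
      rw [tSel, iteFn_of_oneBit (oneBit_isSym 0), if_pos ((hS 0).2 rfl), Function.comp_apply, hv,
        vW0_vArg_of h0 ha0, canonN_apply, bitsToNat_encodeNat]
    have hSs : sSel v = encodeNat (N + k) := by
      rw [sSel, iteFn_of_oneBit (oneBit_isSym 0), if_pos ((hS 0).2 rfl), hnk]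
    rw [hv] at hT hSs
    rw [hGB, layer1_vArg_of hk CliffordTOp.H e rfl hT hSs (fun a => by
      simp only [gateCur, Fin.ext_iff])]
    simp only [gateOps, List.map_cons, List.map_nil, DOp.map, encList_cons, encList_nil]
  | S =>
    have h0 : w0F (QGate.gate CliffordTOp.S e : QGate cliffordT N).encode = encodeNat (embS e 0 : ℕ) := w0F_encode_S e
    have ha0 := (length_wire_le_S (N := N) e).trans hcode
    have hkA := kA_vArg_of hk h0 ha0 (em := em)
    rw [← hv] at hkA
    have hGB : gateBlocks v = boolPair (opCode ((DOp.T (k + (embS e 0 : ℕ))).map (rho n T))) [] ++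
        boolPair (opCode ((DOp.T (k + (embS e 0 : ℕ))).map (rho n T))) [] := by
      rw [gateBlocks, iteFn_of_oneBit (oneBit_isSym 0), if_neg (fun h => by have := (hS 0).1 h; simp [symIdx] at this),
        iteFn_of_oneBit (oneBit_isSym 1), if_pos ((hS 1).2 rfl)]
      simp only [gS, gT, Function.comp_apply, fanoutFn_apply, hrC, hkA, tBlockF_apply, bitsToNat_encodeNat]
    have hT : tSel v = encodeNat N := by
      rw [tSel, iteFn_of_oneBit (oneBit_isSym 0), if_neg (fun h => by have := (hS 0).1 h; simp [symIdx] at this),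
        iteFn_of_oneBit (oneBit_isSym 3), if_neg (fun h => by have := (hS 3).1 h; simp [symIdx] at this),
        Function.comp_apply, hcN]
    have hSs : sSel v = encodeNat 0 := by
      rw [sSel, iteFn_of_oneBit (oneBit_isSym 0), if_neg (fun h => by have := (hS 0).1 h; simp [symIdx] at this),
        iteFn_of_oneBit (oneBit_isSym 3), if_neg (fun h => by have := (hS 3).1 h; simp [symIdx] at this)]
    rw [hv] at hT hSs
    rw [hGB, layer1_vArg_of hk CliffordTOp.S e rfl hT hSs (fun a => by
      simp only [gateCur]; rw [if_neg (Nat.ne_of_lt a.isLt)])]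
    simp only [gateOps, List.map_cons, List.map_nil, DOp.map, encList_cons, encList_nil, List.append_assoc]
    rw [boolPair_eq_append (opCode (DOp.T (rho n T (k + (embS e 0 : ℕ))))) (boolPair _ [])]
    simp only [List.append_assoc]
  | T =>
    have h0 : w0F (QGate.gate CliffordTOp.T e : QGate cliffordT N).encode = encodeNat (embT e 0 : ℕ) := w0F_encode_T e
    have ha0 := (length_wire_le_T (N := N) e).trans hcode
    have hkA := kA_vArg_of hk h0 ha0 (em := em)
    rw [← hv] at hkA
    have hGB : gateBlocks v = boolPair (opCode ((DOp.T (k + (embT e 0 : ℕ))).map (rho n T))) [] := by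
      rw [gateBlocks, iteFn_of_oneBit (oneBit_isSym 0), if_neg (fun h => by have := (hS 0).1 h; simp [symIdx] at this),
        iteFn_of_oneBit (oneBit_isSym 1), if_neg (fun h => by have := (hS 1).1 h; simp [symIdx] at this),
        iteFn_of_oneBit (oneBit_isSym 2), if_pos ((hS 2).2 rfl)]
      simp only [gT, Function.comp_apply, fanoutFn_apply, hrC, hkA, tBlockF_apply, bitsToNat_encodeNat]
    have hT : tSel v = encodeNat N := by
      rw [tSel, iteFn_of_oneBit (oneBit_isSym 0), if_neg (fun h => by have := (hS 0).1 h; simp [symIdx] at this),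
        iteFn_of_oneBit (oneBit_isSym 3), if_neg (fun h => by have := (hS 3).1 h; simp [symIdx] at this),
        Function.comp_apply, hcN]
    have hSs : sSel v = encodeNat 0 := by
      rw [sSel, iteFn_of_oneBit (oneBit_isSym 0), if_neg (fun h => by have := (hS 0).1 h; simp [symIdx] at this),
        iteFn_of_oneBit (oneBit_isSym 3), if_neg (fun h => by have := (hS 3).1 h; simp [symIdx] at this)]
    rw [hv] at hT hSs
    rw [hGB, layer1_vArg_of hk CliffordTOp.T e rfl hT hSs (fun a => by
      simp only [gateCur]; rw [if_neg (Nat.ne_of_lt a.isLt)])]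
    simp only [gateOps, List.map_cons, List.map_nil, DOp.map, encList_cons, encList_nil]
  | CNOT =>
    have h0 : w0F (QGate.gate CliffordTOp.CNOT e : QGate cliffordT N).encode = encodeNat (embC e 0 : ℕ) := w0F_encode_CNOT e
    have h1 : w1F (QGate.gate CliffordTOp.CNOT e : QGate cliffordT N).encode = encodeNat (embC e 1 : ℕ) := w1F_encode_CNOT e
    have ha0 := (length_wires_le_CNOT (N := N) e).1.trans hcode
    have hb1 := (length_wires_le_CNOT (N := N) e).2.trans hcode
    have hkA := kA_vArg_of hk h0 ha0 (em := em)
    have hkB := kB_vArg_of hk h1 hb1 (em := em)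
    rw [← hv] at hkA hkB
    have hGB : gateBlocks v = boolPair (opCode ((DOp.CZ (k + (embC e 1 : ℕ)) (N + k)).map (rho n T))) [] ++
        (boolPair (opCode ((DOp.CZ (k + (embC e 0 : ℕ)) (N + k)).map (rho n T))) [] ++
          boolPair (opCode ((DOp.CZ (N + k) (N + k + 1)).map (rho n T))) []) := by
      rw [gateBlocks, iteFn_of_oneBit (oneBit_isSym 0), if_neg (fun h => by have := (hS 0).1 h; simp [symIdx] at this),
        iteFn_of_oneBit (oneBit_isSym 1), if_neg (fun h => by have := (hS 1).1 h; simp [symIdx] at this),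
        iteFn_of_oneBit (oneBit_isSym 2), if_neg (fun h => by have := (hS 2).1 h; simp [symIdx] at this),
        iteFn_of_oneBit (oneBit_isSym 3), if_pos ((hS 3).2 rfl)]
      simp only [gC, gC1, gH, gC3, Function.comp_apply, fanoutFn_apply, hrC, hkA, hkB, hnk, hnk1, czBlockF_apply,
        bitsToNat_encodeNat]
    have hT : tSel v = encodeNat (embC e 1 : ℕ) := by
      rw [tSel, iteFn_of_oneBit (oneBit_isSym 0), if_neg (fun h => by have := (hS 0).1 h; simp [symIdx] at this),
        iteFn_of_oneBit (oneBit_isSym 3), if_pos ((hS 3).2 rfl), Function.comp_apply, hv,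
        vW1_vArg_of h1 hb1, canonN_apply, bitsToNat_encodeNat]
    have hSs : sSel v = encodeNat (N + k + 1) := by
      rw [sSel, iteFn_of_oneBit (oneBit_isSym 0), if_neg (fun h => by have := (hS 0).1 h; simp [symIdx] at this),
        iteFn_of_oneBit (oneBit_isSym 3), if_pos ((hS 3).2 rfl), hnk1]
    rw [hv] at hT hSs
    rw [hGB, layer1_vArg_of hk CliffordTOp.CNOT e rfl hT hSs (fun a => by
      simp only [gateCur, Fin.ext_iff])]
    simp only [gateOps, List.map_cons, List.map_nil, DOp.map, encList_cons, encList_nil, List.append_assoc]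
    rw [boolPair_eq_append (opCode (DOp.CZ (rho n T (k + (embC e 1 : ℕ))) (rho n T (N + k)))) (boolPair _ (boolPair _ [])),
      boolPair_eq_append (opCode (DOp.CZ (rho n T (k + (embC e 0 : ℕ))) (rho n T (N + k)))) (boolPair _ [])]
    simp only [List.append_assoc]

end Value

/-! ### Growth of the step on every input -/

section Growth

variable (v : List Bool)

/-- Length bound (`length_vCtx_le`), on every input. [folklore] -/
theorem length_vCtx_le : (vCtx v).length ≤ (fstF v).length := by
  have := length_fstF_sndF_le (fstF v); simp only [vCtx, Function.comp_apply]; omega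
/-- Length bound (`length_cY1_le`), on every input. [folklore] -/
theorem length_cY1_le (c : List Bool) : (cY1 c).length ≤ c.length := by
  have := length_fstF_sndF_le c; have := length_fstF_sndF_le (sndF c); simp only [cY1, Function.comp_apply]; omega
/-- Length bound (`length_cRho_le`), on every input. [folklore] -/
theorem length_cRho_le (c : List Bool) : (cRho c).length ≤ c.length := by
  have := length_fstF_sndF_le c; have := length_fstF_sndF_le (sndF c); have := length_fstF_sndF_le (sndF (sndF c))
  simp only [cRho, Function.comp_apply]; omega
/-- Length bound (`length_cN_le`), on every input. [folklore] -/
theorem length_cN_le (c : List Bool) : (cN c).length ≤ c.length := by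
  have := length_fstF_sndF_le c; have := length_fstF_sndF_le (sndF c); have := length_fstF_sndF_le (sndF (sndF c))
  simp only [cN, Function.comp_apply]; omega
/-- Length bound (`length_rCtx_le`), on every input. [folklore] -/
theorem length_rCtx_le : (rCtx v).length ≤ (fstF v).length :=
  (length_cRho_le _).trans (length_vCtx_le v)
/-- Length bound (`length_cNv_le`), on every input. [folklore] -/
theorem length_cNv_le : (cN (vCtx v)).length ≤ (fstF v).length := (length_cN_le _).trans (length_vCtx_le v)
/-- Length bound (`length_cY1v_le`), on every input. [folklore] -/
theorem length_cY1v_le : (cY1 (vCtx v)).length ≤ (fstF v).length := (length_cY1_le _).trans (length_vCtx_le v)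
/-- Length bound (`length_vK_le`), on every input. [folklore] -/
theorem length_vK_le : (vK v).length ≤ (fstF v).length + 1 := by
  have := length_clipF_le 1 (fstF ∘ sndF ∘ sndF) v; rw [one_mul] at this; exact this
/-- Length bound (`length_vW0_le`), on every input. [folklore] -/
theorem length_vW0_le : (vW0 v).length ≤ (fstF v).length + 1 := by
  have := length_clipF_le 1 (w0F ∘ vCode) v; rw [one_mul] at this; exact this
/-- Length bound (`length_vW1_le`), on every input. [folklore] -/
theorem length_vW1_le : (vW1 v).length ≤ (fstF v).length + 1 := by
  have := length_clipF_le 1 (w1F ∘ vCode) v; rw [one_mul] at this; exact this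
/-- Length bound (`length_kA_le`), on every input. [folklore] -/
theorem length_kA_le : (kA v).length ≤ 2 * (fstF v).length + 3 := by
  have := length_encodeNat_add_le (vK v) (vW0 v); have := length_vK_le v; have := length_vW0_le v
  simp only [kA, Function.comp_apply, fanoutFn_apply, addFn_boolPair]; omega
/-- Length bound (`length_kB_le`), on every input. [folklore] -/
theorem length_kB_le : (kB v).length ≤ 2 * (fstF v).length + 3 := by
  have := length_encodeNat_add_le (vK v) (vW1 v); have := length_vK_le v; have := length_vW1_le v
  simp only [kB, Function.comp_apply, fanoutFn_apply, addFn_boolPair]; omega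
/-- Length bound (`length_nk_le`), on every input. [folklore] -/
theorem length_nk_le : (nk v).length ≤ 2 * (fstF v).length + 2 := by
  have := length_encodeNat_add_le (cN (vCtx v)) (vK v); have := length_vK_le v; have := length_cNv_le v
  simp only [nk, Function.comp_apply, fanoutFn_apply, addFn_boolPair]; omega
/-- Length bound (`length_nk1_le`), on every input. [folklore] -/
theorem length_nk1_le : (nk1 v).length ≤ 2 * (fstF v).length + 4 := by
  have := length_succN_le (nk v); have := length_nk_le v; simp only [nk1, Function.comp_apply]; omega
/-- Length bound (`length_eB_le`), on every input. [folklore] -/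
theorem length_eB_le : (eB v).length ≤ 2 := by
  have h := length_extraU_le (vCode v)
  simp only [eB, Function.comp_apply, lenBinF_apply]
  exact (length_encodeNat_le_self _).trans h
/-- Length bound (`length_bB_le`), on every input. [folklore] -/
theorem length_bB_le : (bB v).length ≤ 2 * (fstF v).length + 5 := by
  have := length_encodeNat_add_le (nk v) (eB v); have := length_nk_le v; have := length_eB_le v
  simp only [bB, Function.comp_apply, fanoutFn_apply, addFn_boolPair]; omega
/-- Length bound (`length_b2B_le`), on every input. [folklore] -/
theorem length_b2B_le : (b2B v).length ≤ 3 * (fstF v).length + 6 := by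
  have := length_encodeNat_add_le (bB v) (cN (vCtx v)); have := length_bB_le v; have := length_cNv_le v
  simp only [b2B, Function.comp_apply, fanoutFn_apply, addFn_boolPair]; omega
/-- Length bound (`length_gH_le`), on every input. [folklore] -/
theorem length_gH_le : (gH v).length ≤ 64 * (fstF v).length + 200 := by
  have h := length_czBlockF_le (boolPair (rCtx v) (boolPair (kA v) (nk v)))
  have := length_rCtx_le v; have := length_kA_le v; have := length_nk_le v
  simp only [length_boolPair] at h
  simp only [gH, Function.comp_apply, fanoutFn_apply]; omega
/-- Length bound (`length_gC1_le`), on every input. [folklore] -/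
theorem length_gC1_le : (gC1 v).length ≤ 64 * (fstF v).length + 200 := by
  have h := length_czBlockF_le (boolPair (rCtx v) (boolPair (kB v) (nk v)))
  have := length_rCtx_le v; have := length_kB_le v; have := length_nk_le v
  simp only [length_boolPair] at h
  simp only [gC1, Function.comp_apply, fanoutFn_apply]; omega
/-- Length bound (`length_gC3_le`), on every input. [folklore] -/
theorem length_gC3_le : (gC3 v).length ≤ 64 * (fstF v).length + 200 := by
  have h := length_czBlockF_le (boolPair (rCtx v) (boolPair (nk v) (nk1 v)))
  have := length_rCtx_le v; have := length_nk_le v; have := length_nk1_le v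
  simp only [length_boolPair] at h
  simp only [gC3, Function.comp_apply, fanoutFn_apply]; omega
/-- Length bound (`length_gT_le`), on every input. [folklore] -/
theorem length_gT_le : (gT v).length ≤ 16 * (fstF v).length + 70 := by
  have h := length_tBlockF_le (boolPair (rCtx v) (kA v))
  have := length_rCtx_le v; have := length_kA_le v
  simp only [length_boolPair] at h
  simp only [gT, Function.comp_apply, fanoutFn_apply]; omega
/-- Length bound (`length_gateBlocks_le`), on every input. [folklore] -/
theorem length_gateBlocks_le : (gateBlocks v).length ≤ 192 * (fstF v).length + 600 := by
  have h1 := length_gH_le v; have h2 := length_gC1_le v; have h3 := length_gC3_le v; have h4 := length_gT_le v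
  rw [gateBlocks, iteFn_of_oneBit (oneBit_isSym 0)]
  split_ifs
  · omega
  · rw [iteFn_of_oneBit (oneBit_isSym 1)]
    split_ifs
    · simp only [gS, List.length_append]; omega
    · rw [iteFn_of_oneBit (oneBit_isSym 2)]
      split_ifs
      · omega
      · rw [iteFn_of_oneBit (oneBit_isSym 3)]
        split_ifs
        · simp only [gC, List.length_append]; omega
        · simp
/-- Length bound (`length_tSel_le`), on every input. [folklore] -/
theorem length_tSel_le : (tSel v).length ≤ (fstF v).length + 1 := by
  have := length_vW0_le v; have := length_vW1_le v; have := length_cNv_le v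
  have c0 := length_canonN_le (vW0 v); have c1 := length_canonN_le (vW1 v)
  rw [tSel, iteFn_of_oneBit (oneBit_isSym 0)]
  split_ifs
  · simp only [Function.comp_apply]; omega
  · rw [iteFn_of_oneBit (oneBit_isSym 3)]
    split_ifs
    · simp only [Function.comp_apply]; omega
    · simp only [Function.comp_apply]; omega
/-- Length bound (`length_sSel_le`), on every input. [folklore] -/
theorem length_sSel_le : (sSel v).length ≤ 2 * (fstF v).length + 4 := by
  have := length_nk_le v; have := length_nk1_le v
  rw [sSel, iteFn_of_oneBit (oneBit_isSym 0)]
  split_ifs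
  · omega
  · rw [iteFn_of_oneBit (oneBit_isSym 3)]
    split_ifs
    · omega
    · rw [show (encodeNat 0).length = 0 by decide]; omega
/-- Length bound (`length_ctx1_le`), on every input. [folklore] -/
theorem length_ctx1_le : (ctx1 v).length ≤ 18 * (fstF v).length + 34 := by
  have := length_cY1v_le v; have := length_rCtx_le v; have := length_cNv_le v; have := length_vK_le v
  have := length_bB_le v; have := length_tSel_le v; have := length_sSel_le v
  simp only [ctx1, fanoutFn_apply, Function.comp_apply, length_boolPair]; omega
/-- Length bound (`length_ctx2_le`), on every input. [folklore] -/
theorem length_ctx2_le : (ctx2 v).length ≤ 18 * (fstF v).length + 34 := by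
  have := length_cY1v_le v; have := length_rCtx_le v; have := length_cNv_le v
  have := length_bB_le v; have := length_b2B_le v
  simp only [ctx2, fanoutFn_apply, Function.comp_apply, length_boolPair, show (encodeNat 0).length = 0 by decide]; omega

/-- A layer on a context of length `≤ 18U + 34`. [folklore] -/
theorem length_layer_le_of {x : List Bool} {U : ℕ} (hx : x.length ≤ 18 * U + 34) :
    (layerF x).length ≤ 3 * (18 * U + 34) + 6 + (41472 * (U * U) + 158976 * U + 152320) := by
  have hL := length_layerF_le x
  have key : x.length * (128 * (x.length + 1)) ≤ 41472 * (U * U) + 158976 * U + 152320 := by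
    calc x.length * (128 * (x.length + 1)) ≤ (18 * U + 34) * (128 * (18 * U + 34 + 1)) :=
          Nat.mul_le_mul hx (Nat.mul_le_mul_left 128 (by omega))
      _ = 41472 * (U * U) + 158976 * U + 152320 := by ring
  omega

/-- **The growth polynomial of the slot step.** [folklore] -/
def slotG : Polynomial ℕ := 100000 * (X + 2) ^ 2

/-- Auxiliary computation (`slotG_eval`). [folklore] -/
theorem slotG_eval (U : ℕ) : slotG.eval U = 100000 * (U * U) + 400000 * U + 400000 := by
  simp [slotG]; ring

/-- **Polynomial growth of the slot step on every input**: `|slotStep v| ≤ |acc| + slotG (|w|)`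
(`acc = sndF (sndF v)` contains the emitted part, `w = fstF v`). [folklore] -/
theorem length_slotStep_le : (slotStep v).length ≤ (sndF (sndF v)).length + slotG.eval (fstF v).length := by
  have h1 := length_b2B_le v
  have h2 := length_gateBlocks_le v
  have h3 := length_layer_le_of (length_ctx1_le v)
  have h4 := length_layer_le_of (length_ctx2_le v)
  have h5 : (vEm v).length ≤ (sndF (sndF v)).length := by
    have := length_fstF_sndF_le (sndF (sndF v)); simp only [vEm, Function.comp_apply]; omega
  rw [slotStep_eq, length_boolPair, slotG_eval]
  simp only [List.length_append]
  generalize (fstF v).length * (fstF v).length = W at h3 h4 ⊢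
  omega

end Growth

/-- **The fold over the gate codes with the slot step is in `FP`.** [cite: AroraBarak2009, §1.3, §1.4.1] -/
theorem slotFold_mem_FP {ini : List Bool → List Bool} (hini : ini ∈ FP) : foldFn slotStep ini ∈ FP :=
  foldFn_mem_FP_of_poly slotStep_mem_FP hini slotG length_slotStep_le

end HGadget

end Literature.Computability.QuantumComplexity
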